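import Summits.KontsevichZagierPeriods.KontsevichZagierPeriods.Statement
import Summits.KontsevichZagierPeriods.KontsevichZagierPeriods.Theorems.TorsionLogsNeronTorsionFlexRealSigma
import Summits.KontsevichZagierPeriods.KontsevichZagierPeriods.Theorems.TorsionLogsNeronTorsionFlexQuasiPeriod
import Summits.KontsevichZagierPeriods.KontsevichZagierPeriods.Theorems.TorsionLogsNeronTorsionFlexRepValues
import Summits.KontsevichZagierPeriods.KontsevichZagierPeriods.Theorems.HyperbolicBlochOffTetraSectorKernelRungZeroLogRelations
import Summits.KontsevichZagierPeriods.KontsevichZagierPeriods.Theorems.TorsionLogsNeronTorsionSector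
import Summits.KontsevichZagierPeriods.KontsevichZagierPeriods.Theorems.TorsionLogsNeronTorsionSectorStubParametersAlgebraic
import Literature.NumberTheory.Transcendental.KZKernelConjectureForms

/-!
# The Néron duplication value identity and the on-path lemma of the rung `NeronDuplicationChain`

Crux `TorsionLogs.NeronTorsionFlex` (stmt-KontsevichZagierPeriods-13806), line `NeronDuplication`
(`Cruxes/NeronTorsionFlex/Lines/NeronDuplication.lean`). The line's rung `NeronDuplicationChain` —
the Néron duplication formula as an explicit Kontsevich–Zagier chain for an arbitrary real point `P`
of the identity component — was known to follow from the summit `KontsevichZagierPeriods` only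
modulo the classical VALUE identity of its element (`Lines/NeronDuplication_onpath.lean`,
hypothesis `NeronDuplicationValueIdentity`). This file proves that identity unconditionally and
hence the on-path lemma:

* `neronDuplication_value_identity` — for the real curve `y² = f(x) = 4x³ − g₂x − g₃`
  (`g₂³ ≠ 27g₃²`, largest root `e₁ > 0`), a point `x_P > e₁` with `x_{2P} = x_R > e₁`, and the
  four representations `rI = ∫∫_{e₁<x′<x<x_P} x′/(√f√f)`, `rJ` (the same up to `x_R`),
  `rU = ∫∫_{x>x_P, x′>e₁} (g₂x′+2g₃)/(2x′²√f(x′)√f(x))`, `rP` (the same over `x, x′ > e₁`):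
  `4·rJ − 16·rI + 4·rU − 3·rP + log(f(x_P)²/(3e₁² − g₂/4)³) = 0`
  (verbatim the hypothesis `NeronDuplicationValueIdentity` of the line's on-path file).
  With `Λ` the real lattice of invariants `g₂, g₃` (`Ω₀`, `X = ℘|ℝ`, `u_P = ∫_{x_P}^∞ dx/√f`):
  `rI = log‖σ(Ω₀/2)‖ − log‖σ(u_P)‖ − Re ζ(Ω₀/2)(Ω₀/2 − u_P)`, `rU = u_P·η`, `rP = (Ω₀/2)·η`,
  `η = 2 Re ζ(Ω₀/2)`; the identity is then `σ(2u) = −℘′(u)σ(u)⁴`, the reflection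
  `|σ(Ω₀ − 2u)| = e^{−η(2u − Ω₀/2)}|σ(2u)|` (according as `x(2u_P)` is reached at `2u_P` or
  `Ω₀ − 2u_P`) and the constant `‖σ(Ω₀/2)‖⁴(3e₁² − g₂/4) = e^{ηΩ₀/2}` — Silverman ATAEC VI Thm 1.1,
  Thm 3.2 (`λ(2P) = 4λ(P) − log|2y| + ¼ log|Δ|`) read in the tree's integral language.
* `neronDuplicationChain_of_kontsevichZagierPeriods` — **`KontsevichZagierPeriods →` (the rung,
  verbatim the body of `NeronDuplication.NeronDuplicationChain`)**: the summit in kernel form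
  (`kzKernelConjecture_iff_isRational`) turns the vanishing value into a relation; the log carrier
  exists because the parameters are algebraic (`stub_parametersAlgebraic`, `exists_logRep`).

References: J. H. Silverman, *Advanced Topics in the Arithmetic of Elliptic Curves* (1994), VI §1,
§3; S. Lang, *Fundamentals of Diophantine Geometry* (1983), Ch. 13 §1; Whittaker–Watson §20.
-/

-- single-conjunct summit: Sub = Summit, so the namespace segment repeats by design (CONVENTIONS §2)
set_option linter.dupNamespace false

noncomputable section

open Set MeasureTheory Filter Topology Complex
open scoped PeriodPair
open Literature.NumberTheory.Transcendental
open Summit.KontsevichZagierPeriods.KontsevichZagierPeriods.Cruxes.NeronTorsionSector.Translation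
  (weierstrassPRe_half_eq integral_Ioi_weierstrassPRe_eq weierstrassPRe_two_mul weierstrassPRe_eq_iff
    two_mul_ofReal_notMem_lattice logRep_value stub_parametersAlgebraic)
open Summit.KontsevichZagierPeriods.HyperbolicBloch.OffTetraSectorKernel (exists_logRep)

namespace Summit.KontsevichZagierPeriods.KontsevichZagierPeriods.TorsionLogs.NeronDuplication

/-! ### The value identity -/

/-- **The Néron duplication value identity** (`NeronDuplicationValueIdentity` of the line's on-path
file, now a theorem): `4·rJ.value − 16·rI.value + 4·rU.value − 3·rP.value + log(f(x_P)²/D³) = 0`,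
`D = 3e₁² − g₂/4`. [cite: Silverman1994, Thm VI.3.2] -/
theorem neronDuplication_value_identity :
    ∀ (g₂ g₃ e₁ xP xR : ℝ) (f : ℝ → ℝ),
    (∀ x, f x = 4 * x ^ 3 - g₂ * x - g₃) → g₂ ^ 3 - 27 * g₃ ^ 2 ≠ 0 → f e₁ = 0 → 0 < e₁ →
    (∀ x, e₁ < x → 0 < f x) → e₁ < xP →
    xR = (12 * xP ^ 2 - g₂) ^ 2 / (16 * f xP) - 2 * xP → e₁ < xR →
    ∀ (rI rJ rU rP : KZ.IntegralRep 2),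
      rI.domain = {z | e₁ < z 1 ∧ z 1 < z 0 ∧ z 0 < xP} →
      Set.EqOn rI.integrand (fun z => z 1 / (Real.sqrt (f (z 1)) * Real.sqrt (f (z 0)))) rI.domain →
      rJ.domain = {z | e₁ < z 1 ∧ z 1 < z 0 ∧ z 0 < xR} →
      Set.EqOn rJ.integrand (fun z => z 1 / (Real.sqrt (f (z 1)) * Real.sqrt (f (z 0)))) rJ.domain →
      rU.domain = {z | xP < z 0 ∧ e₁ < z 1} →
      Set.EqOn rU.integrand
        (fun z => (Real.sqrt (f (z 0)))⁻¹ * ((g₂ * z 1 + 2 * g₃) / (2 * (z 1) ^ 2 * Real.sqrt (f (z 1))))) rU.domain →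
      rP.domain = {z | e₁ < z 0 ∧ e₁ < z 1} →
      Set.EqOn rP.integrand
        (fun z => (Real.sqrt (f (z 0)))⁻¹ * ((g₂ * z 1 + 2 * g₃) / (2 * (z 1) ^ 2 * Real.sqrt (f (z 1))))) rP.domain →
      4 * rJ.value - 16 * rI.value + 4 * rU.value - 3 * rP.value
        + Real.log ((f xP) ^ 2 / (3 * e₁ ^ 2 - g₂ / 4) ^ 3) = 0 := by
  intro g₂ g₃ e₁ xP xR f hf hΔ hfe he₁ hpos hxP hxR he₁R rI rJ rU rP hIdom hIint hJdom hJint hUdom hUint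
    hPdom hPint
  -- the real lattice with invariants `g₂, g₃`
  obtain ⟨L, hL2, hL3⟩ :=
    PeriodPair.uniformization_holds (g₂ : ℂ) (g₃ : ℂ) (by exact_mod_cast hΔ)
  have hR : L.IsReal := PeriodPair.isReal_of_g₂_g₃_real PeriodPair.uniformization_unique_holds
    (by rw [hL2]; exact Complex.ofReal_im g₂) (by rw [hL3]; exact Complex.ofReal_im g₃)
  have hg2 : L.g₂.re = g₂ := by rw [hL2, Complex.ofReal_re]
  have hg3 : L.g₃.re = g₃ := by rw [hL3, Complex.ofReal_re]
  have hfun : f = fun x => 4 * x ^ 3 - g₂ * x - g₃ := funext hf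
  subst hfun hg2 hg3
  simp only at hfe hpos hxR hIint hJint hUint hPint ⊢
  set T := L.minRealPeriod / 2 with hT
  have hΩ := hR.minRealPeriod_pos
  have hT0 : 0 < T := by positivity
  have hXT : L.weierstrassPRe T = e₁ := weierstrassPRe_half_eq hR hfe hpos
  -- parameters of `P` and `2P`
  have hsurj : ∀ x, e₁ < x → ∃ u ∈ Ioo 0 T, L.weierstrassPRe u = x := by
    intro x hx
    have hx' : x ∈ Ioi (L.weierstrassPRe (L.minRealPeriod / 2)) := by rw [← hT, hXT]; exact hx
    rw [← hR.image_weierstrassPRe_Ioo] at hx'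
    obtain ⟨u, hu, rfl⟩ := hx'
    exact ⟨u, hu, rfl⟩
  obtain ⟨uP, huP, hXuP⟩ := hsurj xP hxP
  obtain ⟨uR, huR, hXuR⟩ := hsurj xR he₁R
  have huP' : uP ∈ Ioo 0 L.minRealPeriod := ⟨huP.1, by rw [hT] at huP; linarith [huP.2]⟩
  have huR' : uR ∈ Ioo 0 L.minRealPeriod := ⟨huR.1, by rw [hT] at huR; linarith [huR.2]⟩
  have huPne : uP ≠ L.minRealPeriod / 2 := by rw [← hT]; exact huP.2.ne
  have huPn : (uP : ℂ) ∉ L.lattice := hR.ofReal_notMem_lattice huP'.1 huP'.2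
  have hY2 : L.derivWeierstrassPRe uP ^ 2 = 4 * xP ^ 3 - L.g₂.re * xP - L.g₃.re := by
    rw [← hXuP]; exact hR.derivWeierstrassPRe_sq huPn
  have hfP : 0 < 4 * xP ^ 3 - L.g₂.re * xP - L.g₃.re := hpos xP hxP
  have hY0 : L.derivWeierstrassPRe uP ≠ 0 := by
    intro h0; rw [h0] at hY2; linarith [hY2]
  -- `X(2u_P) = x_R`, hence `u_R = 2u_P` or `u_R + 2u_P = Ω₀`
  have hX2 : L.weierstrassPRe (2 * uP) = xR := by
    rw [(weierstrassPRe_two_mul hR huP' huPne).1, hXuP, hxR, div_pow, hY2]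
    field_simp
    ring
  have h2uP : 2 * uP ∈ Ioo 0 L.minRealPeriod := ⟨by linarith [huP.1], by rw [hT] at huP; linarith [huP.2]⟩
  have hcases : 2 * uP = uR ∨ 2 * uP + uR = L.minRealPeriod :=
    (weierstrassPRe_eq_iff hR h2uP huR').1 (by rw [hX2, hXuR])
  -- the four values
  have hI : rI.value = Real.log ‖L.weierstrassSigma ((L.minRealPeriod / 2 : ℝ) : ℂ)‖ -
      Real.log ‖L.weierstrassSigma uP‖ -
      (L.weierstrassZeta ((L.minRealPeriod / 2 : ℝ) : ℂ)).re * (L.minRealPeriod / 2 - uP) := by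
    rw [value_triangle_eq xP e₁ (fun x => 4 * x ^ 3 - L.g₂.re * x - L.g₃.re) rI hIdom hIint,
      ← iterated_integral_weierstrassPRe hR huP, ← hT, hXT, hXuP]
  have hJ : rJ.value = Real.log ‖L.weierstrassSigma ((L.minRealPeriod / 2 : ℝ) : ℂ)‖ -
      Real.log ‖L.weierstrassSigma uR‖ -
      (L.weierstrassZeta ((L.minRealPeriod / 2 : ℝ) : ℂ)).re * (L.minRealPeriod / 2 - uR) := by
    rw [value_triangle_eq xR e₁ (fun x => 4 * x ^ 3 - L.g₂.re * x - L.g₃.re) rJ hJdom hJint,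
      ← iterated_integral_weierstrassPRe hR huR, ← hT, hXT, hXuR]
  have hE : ∫ x in Ioi e₁, (L.g₂.re * x + 2 * L.g₃.re) /
      (2 * x ^ 2 * Real.sqrt (4 * x ^ 3 - L.g₂.re * x - L.g₃.re)) =
      2 * (L.weierstrassZeta ((L.minRealPeriod / 2 : ℝ) : ℂ)).re := by
    rw [← integral_quasiPeriodDensity_eq hR (by rw [← hT, hXT]; exact he₁), ← hT, hXT]
  have hω1 : ∫ x in Ioi xP, (Real.sqrt (4 * x ^ 3 - L.g₂.re * x - L.g₃.re))⁻¹ = uP := by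
    rw [← hXuP]; exact integral_Ioi_weierstrassPRe_eq hR ⟨huP.1, by rw [hT] at huP; exact huP.2.le⟩
  have hω2 : ∫ x in Ioi e₁, (Real.sqrt (4 * x ^ 3 - L.g₂.re * x - L.g₃.re))⁻¹ = T := by
    rw [← hXT, hT]; exact hR.integral_Ioi_inv_sqrt_cubic_eq
  have hU : rU.value = uP * (2 * (L.weierstrassZeta ((L.minRealPeriod / 2 : ℝ) : ℂ)).re) := by
    rw [value_quadrant_eq xP e₁ (fun x => (Real.sqrt (4 * x ^ 3 - L.g₂.re * x - L.g₃.re))⁻¹)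
      (fun x => (L.g₂.re * x + 2 * L.g₃.re) / (2 * x ^ 2 * Real.sqrt (4 * x ^ 3 - L.g₂.re * x - L.g₃.re)))
      rU hUdom hUint, hω1, hE]
  have hPv : rP.value = T * (2 * (L.weierstrassZeta ((L.minRealPeriod / 2 : ℝ) : ℂ)).re) := by
    rw [value_quadrant_eq e₁ e₁ (fun x => (Real.sqrt (4 * x ^ 3 - L.g₂.re * x - L.g₃.re))⁻¹)
      (fun x => (L.g₂.re * x + 2 * L.g₃.re) / (2 * x ^ 2 * Real.sqrt (4 * x ^ 3 - L.g₂.re * x - L.g₃.re)))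
      rP hPdom hPint, hω2, hE]
  -- the logarithmic term
  obtain ⟨hDpos, hconst⟩ := four_mul_log_norm_weierstrassSigma_half hR
  rw [← hT, hXT] at hDpos hconst
  have hηre : (L.quasiPeriodMap L.minRealPeriod).re =
      2 * (L.weierstrassZeta ((L.minRealPeriod / 2 : ℝ) : ℂ)).re := by
    rw [quasiPeriodMap_minRealPeriod hR]
    simp [Complex.mul_re]
  rw [hηre] at hconst
  have hlogf : Real.log ((4 * xP ^ 3 - L.g₂.re * xP - L.g₃.re) ^ 2 / (3 * e₁ ^ 2 - L.g₂.re / 4) ^ 3) =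
      4 * Real.log |L.derivWeierstrassPRe uP| - 3 * Real.log (3 * e₁ ^ 2 - L.g₂.re / 4) := by
    rw [Real.log_div (pow_ne_zero 2 hfP.ne') (pow_ne_zero 3 hDpos.ne'), Real.log_pow, Real.log_pow,
      ← hY2, Real.log_pow, ← Real.log_abs]
    push_cast
    ring
  -- duplication in absolute value
  have hS1 := log_norm_weierstrassSigma_two_mul hR huP' huPne
  rw [hJ, hI, hU, hPv, hlogf]
  rcases hcases with h2 | h2
  · -- `u_R = 2u_P`
    rw [← h2, hS1]
    rw [hT] at *
    linear_combination (-3 : ℝ) * hconst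
  · -- `u_R = Ω₀ − 2u_P`
    have h2' : uR = L.minRealPeriod - 2 * uP := by linarith
    have h2uPn : ((2 * uP : ℝ) : ℂ) ∉ L.lattice := hR.ofReal_notMem_lattice h2uP.1 h2uP.2
    have hS2 := log_norm_weierstrassSigma_minRealPeriod_sub hR h2uPn
    rw [hηre] at hS2
    rw [h2', hS2, hS1]
    rw [hT] at *
    linear_combination (-3 : ℝ) * hconst


/-! ### The on-path lemma: the summit implies the rung -/

/-- `D = 3e₁² − g₂/4 = f′(e₁)/4 > 0`: `e₁` is a simple root (`Δ ≠ 0`) right of which `f > 0`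
(elementary; the same lemma as `disc_pos` of the line's on-path workfile). [folklore] -/
theorem disc_pos {g₂ g₃ e₁ : ℝ} {f : ℝ → ℝ} (hf : ∀ x, f x = 4 * x ^ 3 - g₂ * x - g₃)
    (hΔ : g₂ ^ 3 - 27 * g₃ ^ 2 ≠ 0) (hfe : f e₁ = 0) (he₁ : 0 < e₁)
    (hpos : ∀ x, e₁ < x → 0 < f x) : 0 < 3 * e₁ ^ 2 - g₂ / 4 := by
  have hg₃ : g₃ = 4 * e₁ ^ 3 - g₂ * e₁ := by have h := hf e₁; rw [hfe] at h; linarith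
  have hfac : ∀ x, f x = (x - e₁) * (4 * (x - e₁) ^ 2 + 12 * e₁ * (x - e₁) + 4 * (3 * e₁ ^ 2 - g₂ / 4)) := by
    intro x; rw [hf x, hg₃]; ring
  set D := 3 * e₁ ^ 2 - g₂ / 4 with hD
  have hD0 : D ≠ 0 := by
    intro h0
    apply hΔ
    have hg₂ : g₂ = 12 * e₁ ^ 2 := by linarith
    rw [hg₃, hg₂]; ring
  rcases lt_or_gt_of_ne hD0 with hneg | hposD
  · exfalso
    set t := min 1 (-D / (3 * e₁ + 2)) with ht
    have h32 : 0 < 3 * e₁ + 2 := by linarith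
    have ht0 : 0 < t := lt_min one_pos (div_pos (by linarith) h32)
    have ht1 : t ≤ 1 := min_le_left _ _
    have ht2 : t ≤ -D / (3 * e₁ + 2) := min_le_right _ _
    have ht3 : t * (3 * e₁ + 2) ≤ -D := (le_div_iff₀ h32).1 ht2
    have hx : e₁ < e₁ + t := by linarith
    have h := hpos (e₁ + t) hx
    rw [hfac] at h
    have hs : e₁ + t - e₁ = t := by ring
    rw [hs] at h
    have hq : 4 * t ^ 2 + 12 * e₁ * t + 4 * D ≤ 0 := by nlinarith
    nlinarith
  · exact hposD

/-- **On-path lemma (F4) for the rung `NeronDuplicationChain` of line `NeronDuplication`**: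
`KontsevichZagierPeriods →` the Néron duplication chain (the conclusion is VERBATIM the body of
`Cruxes.NeronTorsionFlex.NeronDuplication.NeronDuplicationChain`). Given the value identity
`neronDuplication_value_identity`, the summit in kernel form (`kzKernelConjecture_iff_isRational`)
turns the vanishing value of `4[rJ] − 16[rI] + 4[rU] − 3[rP] + c[rB]` into a relation; the log
carrier `rB = [1 < t < B, dt/t]`, `B^c = f(x_P)²/D³`, exists because `g₂, g₃, e₁, x_P` are algebraic
(`stub_parametersAlgebraic`, `exists_logRep`). [cite: KontsevichZagier2001, §1.2] -/
theorem neronDuplicationChain_of_kontsevichZagierPeriods (hS : KontsevichZagierPeriods) :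
    ∀ (g₂ g₃ e₁ xP xR : ℝ) (f : ℝ → ℝ),
    (∀ x, f x = 4 * x ^ 3 - g₂ * x - g₃) → g₂ ^ 3 - 27 * g₃ ^ 2 ≠ 0 → f e₁ = 0 → 0 < e₁ →
    (∀ x, e₁ < x → 0 < f x) → e₁ < xP →
    xR = (12 * xP ^ 2 - g₂) ^ 2 / (16 * f xP) - 2 * xP → e₁ < xR →
    ∀ (rI rJ rU rP : KZ.IntegralRep 2),
      rI.domain = {z | e₁ < z 1 ∧ z 1 < z 0 ∧ z 0 < xP} →
      Set.EqOn rI.integrand (fun z => z 1 / (Real.sqrt (f (z 1)) * Real.sqrt (f (z 0)))) rI.domain →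
      rJ.domain = {z | e₁ < z 1 ∧ z 1 < z 0 ∧ z 0 < xR} →
      Set.EqOn rJ.integrand (fun z => z 1 / (Real.sqrt (f (z 1)) * Real.sqrt (f (z 0)))) rJ.domain →
      rU.domain = {z | xP < z 0 ∧ e₁ < z 1} →
      Set.EqOn rU.integrand
        (fun z => (Real.sqrt (f (z 0)))⁻¹ * ((g₂ * z 1 + 2 * g₃) / (2 * (z 1) ^ 2 * Real.sqrt (f (z 1))))) rU.domain →
      rP.domain = {z | e₁ < z 0 ∧ e₁ < z 1} →
      Set.EqOn rP.integrand
        (fun z => (Real.sqrt (f (z 0)))⁻¹ * ((g₂ * z 1 + 2 * g₃) / (2 * (z 1) ^ 2 * Real.sqrt (f (z 1))))) rP.domain →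
      ∃ (c : ℤ) (B : ℝ) (rB : KZ.IntegralRep 1), 1 < B ∧ IsAlgebraic ℚ B ∧
        B ^ c = (f xP) ^ 2 / (3 * e₁ ^ 2 - g₂ / 4) ^ 3 ∧
        rB.domain = {t | 1 < t 0 ∧ t 0 < B} ∧ Set.EqOn rB.integrand (fun t => (t 0)⁻¹) rB.domain ∧
        (4 : ℤ) • KZ.of rJ - (16 : ℤ) • KZ.of rI + (4 : ℤ) • KZ.of rU - (3 : ℤ) • KZ.of rP + c • KZ.of rB
          ∈ KZ.relations := by
  intro g₂ g₃ e₁ xP xR f hf hΔ hfe he₁ hpos hxP hxR he₁R rI rJ rU rP hIdom hIint hJdom hJint hUdom hUint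
    hPdom hPint
  -- kernel form of the summit
  have hK : KZKernelConjecture := kzKernelConjecture_iff_isRational.mpr hS
  -- parameters are algebraic (read off the semialgebraic data of `rI`, `rP`)
  obtain ⟨hg₂, hg₃, he₁a, hxPa⟩ :=
    stub_parametersAlgebraic g₂ g₃ e₁ xP f hf hfe he₁ hpos hxP rI rP hIdom hIint hPdom hPint
  have hD : 0 < 3 * e₁ ^ 2 - g₂ / 4 := disc_pos hf hΔ hfe he₁ hpos
  set Q : ℝ := (f xP) ^ 2 / (3 * e₁ ^ 2 - g₂ / 4) ^ 3 with hQ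
  have hQpos : 0 < Q := div_pos (pow_pos (hpos xP hxP) 2) (pow_pos hD 3)
  have hQalg : IsAlgebraic ℚ Q := by
    have h4 : IsAlgebraic ℚ (4 : ℝ) := by simpa using isAlgebraic_algebraMap (R := ℚ) (A := ℝ) 4
    have h3 : IsAlgebraic ℚ (3 : ℝ) := by simpa using isAlgebraic_algebraMap (R := ℚ) (A := ℝ) 3
    have h14 : IsAlgebraic ℚ ((4 : ℝ)⁻¹) := h4.inv
    have hfx : IsAlgebraic ℚ (f xP) := by
      rw [hf]
      apply_rules [IsAlgebraic.sub, IsAlgebraic.mul, IsAlgebraic.pow]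
    have hDa : IsAlgebraic ℚ (3 * e₁ ^ 2 - g₂ / 4) := by
      rw [div_eq_mul_inv]
      apply_rules [IsAlgebraic.sub, IsAlgebraic.mul, IsAlgebraic.pow]
    rw [hQ, div_eq_mul_inv]
    exact (hfx.pow 2).mul (hDa.pow 3).inv
  -- choose the carrier `B > 1`, `c ∈ {1, 0, −1}` with `B ^ c = Q`
  obtain ⟨c, B, hB1, hBalg, hBc⟩ : ∃ (c : ℤ) (B : ℝ), 1 < B ∧ IsAlgebraic ℚ B ∧ B ^ c = Q := by
    rcases lt_trichotomy Q 1 with hlt | heq | hgt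
    · refine ⟨-1, Q⁻¹, (one_lt_inv₀ hQpos).2 hlt, hQalg.inv, by simp⟩
    · refine ⟨0, 2, by norm_num, by simpa using isAlgebraic_algebraMap (R := ℚ) (A := ℝ) 2, ?_⟩
      simp [heq]
    · exact ⟨1, Q, hgt, hQalg, by simp⟩
  obtain ⟨rB, hBdom, hBint⟩ := exists_logRep one_pos isAlgebraic_one hBalg
  have hBint' : Set.EqOn rB.integrand (fun t => (t 0)⁻¹) rB.domain := fun t _ => by
    rw [hBint]; simp
  refine ⟨c, B, rB, hB1, hBalg, hBc, hBdom, hBint', hK _ ?_⟩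
  -- the element evaluates to the classical identity
  have hval := neronDuplication_value_identity g₂ g₃ e₁ xP xR f hf hΔ hfe he₁ hpos hxP hxR he₁R
    rI rJ rU rP hIdom hIint hJdom hJint hUdom hUint hPdom hPint
  have hBv : rB.value = Real.log B := logRep_value hB1.le rB hBdom hBint'
  have hlogQ : Real.log Q = (c : ℝ) * Real.log B := by rw [← hBc, Real.log_zpow]
  simp only [map_add, map_sub, map_zsmul, KZ.eval_of, zsmul_eq_mul, hBv, Int.cast_ofNat]
  rw [hQ] at hlogQ
  linarith [hval, hlogQ]

end Summit.KontsevichZagierPeriods.KontsevichZagierPeriods.TorsionLogs.NeronDuplication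

end
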